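import Summits.QuantumFields.BalabanUV.Beta.EriceFlowEnclosureLogMeanClockIntegralEnd

/-!
# Beta / EriceFlowEnclosureCutoffAveragesEnd — THE AVERAGING HIERARCHY ALONG THE TWO-LOOP CLOCK, ON ONE PAGE (END OF GENS 36–38):
# for M bounded, continuous and C-log-Lipschitz on ]0, δ[ (the shape of the three-loop Cesàro datum), `h_n > 0` with `n·h_n → L₀ > 0` (the shape
# of the cutoff couplings on the bare trajectory), `0 < c < δ` and every m,
#     **uniform cutoff average → m  ⟺  every power-weighted cutoff average → m  ⟺  M → m at 0⁺   ⟹   logarithmic cutoff average → m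
#        ⟺  log-scale average `(∫_h^c M ds∕s)∕log(c∕h) → m` at 0⁺**,
# and THE LAST IMPLICATION IS STRICT: one M (`sin(log(L₀∕t))`, all hypotheses with B = C = δ = 1) with NO limit at 0⁺, NO convergent uniform
# cutoff average, and logarithmic cutoff average AND log-scale average both → 0 — the second conclusion now DERIVED from the first through
# P2 #55c's identification (gen 37 proved the two escapes separately, for two different witnesses).  Pure by-name assembly: P2 #53b
# `cutoffAverage_iff` (Schmidt), P2 #54g `powerCutoffAverage_iff` ∕ `escape_clock` ∕ `escape_logLip` ∕ `escape_samples`, P2 #54e `logMean_of_tendsto`,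
# P2 #54f `witness_logMean_tendsto_zero` ∕ `witness_not_tendsto` ∕ `witness_slowlyOscillating`, P2 #53a `cesaro_iff_tendsto_of_slowlyOscillating`,
# P2 #55c `logCutoffAverage_iff_logScaleAverage`.
# (β-flow team, prover 2 = lower ∕ positivity side, unit `b2b-balaban-beta-bflow-p2`, gen 38; module P2 #55g; no Erice sentence occurs)

HONEST FRAMING (page 1 of everything the β sub-cell writes): discharging `BetaPertH` makes Bałaban's UV stability UNCONDITIONAL — a
real constructive-QFT result; it is NOT the continuum limit and NOT the Clay problem.  HONEST DEPENDENCY (cell reorg 2026-08-19,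
verbatim): «continuum YM on T⁴ ⇐ BetaPertH ∧ nine spine estimates (0/9 proved); BetaPertH ⇐ (D1) ∧ (D4) ∧ CAP+tail; G-an2-4 gates
asym, D1 and NE2/3/4.»  THIS MODULE DISCHARGES NOTHING and quotes nothing: [folklore] Tauberian bookkeeping; «cutoff average ∕ datum» are OUR
READINGS of (3.76)'s O(1) term (rows L119–L154), hypotheses on the LIMIT β; the honest Tauberian repair of the last arrow is the power-scale
class (P2 #55d ∕ #55f), which nothing in the lineage supplies for a β-flow datum.

WHAT THIS FILE PROVES (0 sorry, 0 def): `cesaroDeviation_eq`, `weightedDeviation_eq`, `cutoffAverage_iff_datum`, `powerCutoffAverage_iff_datum`,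
`logCutoffAverage_of_datum`, END **`averaging_hierarchy`**, `sin_log_div_continuousOn`, END **`averaging_hierarchy_strict`**.
NOT CLAIMED: anything new — this is the one-page junction of P2 #53b, #54g, #55c; `BetaPertH`; continuum; Clay.
-/

namespace Summit.QuantumFields.BalabanUV.Beta.EriceFlowEnclosureCutoffAveragesEnd

open Set Filter Topology
open Summit.QuantumFields.BalabanUV.Beta.EriceFlowEnclosureCesaroTauberianSeq (cesaro_iff_tendsto_of_slowlyOscillating)
open Summit.QuantumFields.BalabanUV.Beta.EriceFlowEnclosureCesaroClockSampling (cutoffAverage_iff tendsto_sampled_of_tendsto)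
open Summit.QuantumFields.BalabanUV.Beta.EriceFlowEnclosureWeightedClockSampling
  (powerCutoffAverage_iff escape_clock escape_logLip escape_samples)
open Summit.QuantumFields.BalabanUV.Beta.EriceFlowEnclosureLogMeanSeq (logMass_pos logMean_of_tendsto)
open Summit.QuantumFields.BalabanUV.Beta.EriceFlowEnclosureLogMeanEscape
  (witness_logMean_tendsto_zero witness_not_tendsto witness_slowlyOscillating)
open Summit.QuantumFields.BalabanUV.Beta.EriceFlowEnclosureLogMeanClockIntegralEnd (logCutoffAverage_iff_logScaleAverage)

noncomputable section

variable {M : ℝ → ℝ} {h : ℕ → ℝ} {δ C B L₀ : ℝ}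

/-! ## §1 The deviation forms of P2 #53b ∕ #54g, unshifted -/

/-- `N⁻¹·Σ_{n<N} (1·(a n − m) + 0) = N⁻¹·Σ_{n<N} a n − m` for N ≥ 1. [folklore] -/
theorem cesaroDeviation_eq (a : ℕ → ℝ) (m : ℝ) {N : ℕ} (hN : 1 ≤ N) :
    (N : ℝ)⁻¹ * ∑ n ∈ Finset.range N, (1 * (a n - m) + 0) = (N : ℝ)⁻¹ * ∑ n ∈ Finset.range N, a n - m := by
  have hN0 : (N : ℝ) ≠ 0 := Nat.cast_ne_zero.mpr (by omega)
  simp only [one_mul, add_zero, Finset.sum_sub_distrib, Finset.sum_const, Finset.card_range, nsmul_eq_mul]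
  rw [mul_sub, ← mul_assoc, inv_mul_cancel₀ hN0, one_mul]

/-- `(Σ_{n<N} p n·(1·(a n − m) + 0))∕(Σ_{n<N} p n) = (Σ_{n<N} p n·a n)∕(Σ_{n<N} p n) − m` when the mass is non-zero. [folklore] -/
theorem weightedDeviation_eq (p a : ℕ → ℝ) (m : ℝ) {N : ℕ} (hP : ∑ n ∈ Finset.range N, p n ≠ 0) :
    (∑ n ∈ Finset.range N, p n * (1 * (a n - m) + 0)) / (∑ n ∈ Finset.range N, p n)
      = (∑ n ∈ Finset.range N, p n * a n) / (∑ n ∈ Finset.range N, p n) - m := by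
  have hsplit : ∑ n ∈ Finset.range N, p n * (1 * (a n - m) + 0)
      = ∑ n ∈ Finset.range N, p n * a n - m * ∑ n ∈ Finset.range N, p n := by
    rw [Finset.mul_sum, ← Finset.sum_sub_distrib]
    exact Finset.sum_congr rfl fun n _ => by ring
  rw [hsplit, sub_div, mul_div_assoc, div_self hP, mul_one]

/-! ## §2 The four rungs -/

/-- RUNG 1 — **THE UNIFORM CUTOFF AVERAGE DECIDES THE DATUM**: `N⁻¹·Σ_{n<N} M(h_n) → m ⟺ M → m at 0⁺` (P2 #53b `cutoffAverage_iff` with c = 1, e = 0;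
Schmidt's Tauberian theorem on the slowly oscillating samples). [folklore] -/
theorem cutoffAverage_iff_datum (hC : 0 < C) (hδ : 0 < δ)
    (hlip : ∀ t u : ℝ, 0 < t → t ≤ u → u < δ → |M u - M t| ≤ C * Real.log (u / t))
    (hpos : ∀ n, 0 < h n) (hL₀ : 0 < L₀) (hclock : Tendsto (fun n : ℕ => (n : ℝ) * h n) atTop (𝓝 L₀)) (m : ℝ) :
    Tendsto (fun N : ℕ => (N : ℝ)⁻¹ * ∑ n ∈ Finset.range N, M (h n)) atTop (𝓝 m) ↔ Tendsto M (𝓝[>] 0) (𝓝 m) := by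
  obtain ⟨h1, h2, h3⟩ := cutoffAverage_iff hC hδ hlip hpos hL₀ hclock (e := fun _ => (0:ℝ)) tendsto_const_nhds
    (one_ne_zero) m
  rw [← h3, ← h2, ← h1]
  constructor
  · intro hS
    have := hS.sub_const m
    rw [sub_self] at this
    refine this.congr' ?_
    filter_upwards [eventually_ge_atTop 1] with N hN
    exact (cesaroDeviation_eq (fun n => M (h n)) m hN).symm
  · intro hD
    have := hD.add_const m
    rw [zero_add] at this
    refine this.congr' ?_
    filter_upwards [eventually_ge_atTop 1] with N hN
    rw [cesaroDeviation_eq (fun n => M (h n)) m hN]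
    ring

/-- RUNG 2 — **EVERY POWER-WEIGHTED CUTOFF AVERAGE DECIDES THE DATUM** (−1 < σ ≤ 0):
`(Σ_{n<N} (n+1)^σ M(h_n))∕(Σ_{n<N} (n+1)^σ) → m ⟺ M → m at 0⁺` (P2 #54g `powerCutoffAverage_iff`; weighted Schmidt under (G)). [folklore] -/
theorem powerCutoffAverage_iff_datum {σ : ℝ} (hσ1 : -1 < σ) (hσ0 : σ ≤ 0) (hC : 0 < C) (hδ : 0 < δ)
    (hlip : ∀ t u : ℝ, 0 < t → t ≤ u → u < δ → |M u - M t| ≤ C * Real.log (u / t))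
    (hpos : ∀ n, 0 < h n) (hL₀ : 0 < L₀) (hclock : Tendsto (fun n : ℕ => (n : ℝ) * h n) atTop (𝓝 L₀)) (m : ℝ) :
    Tendsto (fun N : ℕ => (∑ n ∈ Finset.range N, ((n : ℝ) + 1) ^ σ * M (h n)) / ∑ n ∈ Finset.range N, ((n : ℝ) + 1) ^ σ)
      atTop (𝓝 m) ↔ Tendsto M (𝓝[>] 0) (𝓝 m) := by
  obtain ⟨h1, h2, h3⟩ := powerCutoffAverage_iff hσ1 hσ0 hC hδ hlip hpos hL₀ hclock (e := fun _ => (0:ℝ)) tendsto_const_nhds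
    (one_ne_zero) m
  rw [← h3, ← h2, ← h1]
  have hP : ∀ N : ℕ, 1 ≤ N → ∑ n ∈ Finset.range N, ((n : ℝ) + 1) ^ σ ≠ 0 := fun N hN =>
    (Finset.sum_pos (fun n _ => Real.rpow_pos_of_pos (by positivity) σ) (Finset.nonempty_range_iff.mpr (by omega))).ne'
  constructor
  · intro hS
    have := hS.sub_const m
    rw [sub_self] at this
    refine this.congr' ?_
    filter_upwards [eventually_ge_atTop 1] with N hN
    exact (weightedDeviation_eq (fun n => ((n : ℝ) + 1) ^ σ) (fun n => M (h n)) m (hP N hN)).symm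
  · intro hD
    have := hD.add_const m
    rw [zero_add] at this
    refine this.congr' ?_
    filter_upwards [eventually_ge_atTop 1] with N hN
    rw [weightedDeviation_eq (fun n => ((n : ℝ) + 1) ^ σ) (fun n => M (h n)) m (hP N hN)]
    ring

/-- RUNG 3 — **THE DATUM GIVES THE LOGARITHMIC CUTOFF AVERAGE** (regularity: the samples converge, P2 #54e `logMean_of_tendsto`). [folklore] -/
theorem logCutoffAverage_of_datum (hpos : ∀ n, 0 < h n) (hclock : Tendsto (fun n : ℕ => (n : ℝ) * h n) atTop (𝓝 L₀))
    {m : ℝ} (hM : Tendsto M (𝓝[>] 0) (𝓝 m)) :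
    Tendsto (fun N : ℕ => (∑ n ∈ Finset.range N, ((n : ℝ) + 1)⁻¹ * M (h n)) / ∑ n ∈ Finset.range N, ((n : ℝ) + 1)⁻¹)
      atTop (𝓝 m) :=
  logMean_of_tendsto (tendsto_sampled_of_tendsto hpos hclock hM)

/-- **END — THE AVERAGING HIERARCHY ALONG THE TWO-LOOP CLOCK.**  M continuous on ]0, δ[ with `|M| ≤ B` and `|M u − M t| ≤ C·log(u∕t)`
(0 < t ≤ u < δ; C > 0); `h_n > 0` with `n·h_n → L₀ > 0`; `0 < c < δ`.  For every m:
**(1) `N⁻¹·Σ_{n<N} M(h_n) → m ⟺ M → m at 0⁺`;  (2) for −1 < σ ≤ 0, `(Σ (n+1)^σ M(h_n))∕(Σ (n+1)^σ) → m ⟺ M → m at 0⁺`;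
(3) `M → m at 0⁺ ⟹ (Σ M(h_n)∕(n+1))∕H_N → m`;  (4) `(Σ M(h_n)∕(n+1))∕H_N → m ⟺ (∫_x^c M ds∕s)∕log(c∕x) → m as x → 0⁺`.**
The converse of (3) fails (`averaging_hierarchy_strict`); its honest repair is the power-scale class (P2 #55d ∕ #55f). [folklore] -/
theorem averaging_hierarchy (hC : 0 < C) (hδ : 0 < δ) (hcont : ContinuousOn M (Ioo 0 δ))
    (hlip : ∀ t u : ℝ, 0 < t → t ≤ u → u < δ → |M u - M t| ≤ C * Real.log (u / t))
    (hB : ∀ s ∈ Ioo 0 δ, |M s| ≤ B) (hpos : ∀ n, 0 < h n) (hL₀ : 0 < L₀)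
    (hclock : Tendsto (fun n : ℕ => (n : ℝ) * h n) atTop (𝓝 L₀)) {c : ℝ} (hc0 : 0 < c) (hcδ : c < δ) (m : ℝ) :
    (Tendsto (fun N : ℕ => (N : ℝ)⁻¹ * ∑ n ∈ Finset.range N, M (h n)) atTop (𝓝 m) ↔ Tendsto M (𝓝[>] 0) (𝓝 m)) ∧
    (∀ σ : ℝ, -1 < σ → σ ≤ 0 →
      (Tendsto (fun N : ℕ => (∑ n ∈ Finset.range N, ((n : ℝ) + 1) ^ σ * M (h n)) / ∑ n ∈ Finset.range N, ((n : ℝ) + 1) ^ σ)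
        atTop (𝓝 m) ↔ Tendsto M (𝓝[>] 0) (𝓝 m))) ∧
    (Tendsto M (𝓝[>] 0) (𝓝 m) →
      Tendsto (fun N : ℕ => (∑ n ∈ Finset.range N, ((n : ℝ) + 1)⁻¹ * M (h n)) / ∑ n ∈ Finset.range N, ((n : ℝ) + 1)⁻¹)
        atTop (𝓝 m)) ∧
    (Tendsto (fun N : ℕ => (∑ n ∈ Finset.range N, ((n : ℝ) + 1)⁻¹ * M (h n)) / ∑ n ∈ Finset.range N, ((n : ℝ) + 1)⁻¹)
        atTop (𝓝 m) ↔
      Tendsto (fun x => (∫ s in x..c, M s / s) / Real.log (c / x)) (𝓝[>] 0) (𝓝 m)) :=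
  ⟨cutoffAverage_iff_datum hC hδ hlip hpos hL₀ hclock m,
    fun _ hσ1 hσ0 => powerCutoffAverage_iff_datum hσ1 hσ0 hC hδ hlip hpos hL₀ hclock m,
    fun hM => logCutoffAverage_of_datum hpos hclock hM,
    logCutoffAverage_iff_logScaleAverage hδ hC.le hcont hlip hB hpos hL₀ hclock hc0 hcδ m⟩

/-! ## §3 The last arrow is strict — one witness for both logarithmic averages -/

/-- `t ↦ sin(log(L₀∕t))` is continuous on ]0, 1[ (L₀ > 0). [folklore] -/
theorem sin_log_div_continuousOn (hL₀ : 0 < L₀) :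
    ContinuousOn (fun t : ℝ => Real.sin (Real.log (L₀ / t))) (Ioo 0 1) := by
  refine Real.continuous_sin.comp_continuousOn ((Real.continuousOn_log.comp
    (continuousOn_const.div continuousOn_id fun t ht => ht.1.ne') fun t ht => ?_))
  exact (div_pos hL₀ ht.1).ne'

/-- **END — THE LAST ARROW IS STRICT, WITH ONE WITNESS FOR BOTH LOGARITHMIC AVERAGES.**  For every L₀ > 0 and `0 < c < 1` there are M
(= `sin(log(L₀∕t))`) and h (= `L₀∕(n+1)`) satisfying ALL hypotheses of `averaging_hierarchy` (δ = B = C = 1, M continuous on ]0, 1[) such that: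
(i) the uniform cutoff average `N⁻¹·Σ_{n<N} M(h_n)` converges to NO value; (ii) M has NO limit at 0⁺; (iii) the logarithmic cutoff average → 0;
and (iv) — DERIVED from (iii) by P2 #55c — the log-scale average `(∫_x^c M ds∕s)∕log(c∕x) → 0` as x → 0⁺. [folklore] -/
theorem averaging_hierarchy_strict (hL₀ : 0 < L₀) {c : ℝ} (hc0 : 0 < c) (hc1 : c < 1) :
    ∃ (M : ℝ → ℝ) (h : ℕ → ℝ),
      (∀ t u : ℝ, 0 < t → t ≤ u → u < 1 → |M u - M t| ≤ 1 * Real.log (u / t)) ∧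
      (∀ s ∈ Ioo (0:ℝ) 1, |M s| ≤ 1) ∧ ContinuousOn M (Ioo 0 1) ∧
      (∀ n, 0 < h n) ∧ Tendsto (fun n : ℕ => (n : ℝ) * h n) atTop (𝓝 L₀) ∧
      (¬ ∃ m' : ℝ, Tendsto (fun N : ℕ => (N : ℝ)⁻¹ * ∑ n ∈ Finset.range N, M (h n)) atTop (𝓝 m')) ∧
      (¬ ∃ m : ℝ, Tendsto M (𝓝[>] 0) (𝓝 m)) ∧
      Tendsto (fun N : ℕ => (∑ n ∈ Finset.range N, ((n : ℝ) + 1)⁻¹ * M (h n)) / ∑ n ∈ Finset.range N, ((n : ℝ) + 1)⁻¹)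
        atTop (𝓝 0) ∧
      Tendsto (fun x => (∫ s in x..c, M s / s) / Real.log (c / x)) (𝓝[>] 0) (𝓝 0) := by
  obtain ⟨hpos, hclock⟩ := escape_clock hL₀
  obtain ⟨hlip, hbdd⟩ := escape_logLip hL₀
  have hB : ∀ s ∈ Ioo (0:ℝ) 1, |Real.sin (Real.log (L₀ / s))| ≤ 1 := fun s hs => hbdd s hs.1 hs.2
  have hcont := sin_log_div_continuousOn hL₀
  have hlog : Tendsto (fun N : ℕ => (∑ n ∈ Finset.range N, ((n : ℝ) + 1)⁻¹ * Real.sin (Real.log (L₀ / (L₀ / ((n : ℝ) + 1))))) /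
      ∑ n ∈ Finset.range N, ((n : ℝ) + 1)⁻¹) atTop (𝓝 0) :=
    witness_logMean_tendsto_zero.congr fun N => by simp only [escape_samples hL₀]
  refine ⟨fun t => Real.sin (Real.log (L₀ / t)), fun n => L₀ / ((n : ℝ) + 1), hlip, hB, hcont, hpos, hclock, ?_, ?_, hlog, ?_⟩
  · rintro ⟨m', hm'⟩
    have hces : Tendsto (fun N : ℕ => (N : ℝ)⁻¹ * ∑ n ∈ Finset.range N, Real.sin (Real.log ((n : ℝ) + 1))) atTop (𝓝 m') :=
      hm'.congr fun N => by simp only [escape_samples hL₀]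
    exact witness_not_tendsto ⟨m', (cesaro_iff_tendsto_of_slowlyOscillating witness_slowlyOscillating m').mp hces⟩
  · rintro ⟨m, hm⟩
    have hs := tendsto_sampled_of_tendsto (M := fun t => Real.sin (Real.log (L₀ / t))) hpos hclock hm
    exact witness_not_tendsto ⟨m, hs.congr fun n => escape_samples hL₀ n⟩
  · exact (logCutoffAverage_iff_logScaleAverage (M := fun t => Real.sin (Real.log (L₀ / t))) one_pos zero_le_one hcont
      hlip hB hpos hL₀ hclock hc0 hc1 0).mp hlog

end

end Summit.QuantumFields.BalabanUV.Beta.EriceFlowEnclosureCutoffAveragesEnd
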